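import Mathlib
import Literature.NumberTheory.Transcendental.KZCalculus

/-!
# `LegendreCubicForm` (stmt-KontsevichZagierPeriods-3521), line `Sketch (hat-box chart)`: stub `stub_hatBoxInjOn`

Pure real algebra: injectivity of the hat-box change of variables
`Λ(λ, μ) = (u, z)`, `u = √((e₃−e₁)(e₂−λ)(μ−e₂)/((e₃−e₂)(λ−e₁)(μ−e₁)))`,
`z = √((e₃−λ)(e₃−μ)/((e₃−e₁)(e₃−e₂)))`, on the open period rectangle `(e₁,e₂) × (e₂,e₃)`.

Proof (Vieta). With `X₁ = (λ−e₁)(μ−e₁)`, `X₂ = (e₂−λ)(μ−e₂)`, `X₃ = (e₃−λ)(e₃−μ)` one has the linear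
relation `X₁(e₃−e₂) + X₂(e₃−e₁) + X₃(e₂−e₁) = (e₂−e₁)(e₃−e₁)(e₃−e₂)`; equality of `u²` gives equality of
the ratios `X₂/X₁`, equality of `z²` gives equality of `X₃`, hence `X₁`, hence `λ+μ` and `λμ` agree,
and `λ < e₂ < μ` pins down the ordered pair. No definitions are introduced.
References: Kontsevich–Zagier 2001 §1.2 (rule (2), change of variables).
-/

noncomputable section

namespace Summit.KontsevichZagierPeriods.UnfoldedStokes.LegendreCubicFormLine

open Set

/-- Vieta step: on the rectangle `a < l < b < m < c` the two squared hat-box coordinates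
`(c−a)(b−l)(m−b)/((c−b)(l−a)(m−a))` and `(c−l)(c−m)/((c−a)(c−b))` determine the ordered pair `(l, m)`. -/
theorem hatBox_vieta {a b c l m l' m' : ℝ}
    (hl1 : a < l) (hl2 : l < b) (hm1 : b < m) (hm2 : m < c)
    (hl1' : a < l') (_hl2' : l' < b) (hm1' : b < m') (_hm2' : m' < c)
    (hA : (c - a) * (b - l) * (m - b) / ((c - b) * (l - a) * (m - a)) =
          (c - a) * (b - l') * (m' - b) / ((c - b) * (l' - a) * (m' - a)))
    (hB : (c - l) * (c - m) / ((c - a) * (c - b)) = (c - l') * (c - m') / ((c - a) * (c - b))) :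
    l = l' ∧ m = m' := by
  have hla : 0 < l - a := sub_pos.mpr hl1
  have hbl : 0 < b - l := sub_pos.mpr hl2
  have hmb : 0 < m - b := sub_pos.mpr hm1
  have hcb : 0 < c - b := sub_pos.mpr (hm1.trans hm2)
  have hca : 0 < c - a := sub_pos.mpr ((hl1.trans hl2).trans (hm1.trans hm2))
  have hma : 0 < m - a := sub_pos.mpr ((hl1.trans hl2).trans hm1)
  have hla' : 0 < l' - a := sub_pos.mpr hl1'
  have hma' : 0 < m' - a := sub_pos.mpr ((hl1.trans hl2).trans hm1')
  have hK : (c - a) * (c - b) ≠ 0 := (mul_pos hca hcb).ne'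
  have hD : (c - b) * (l - a) * (m - a) ≠ 0 := (mul_pos (mul_pos hcb hla) hma).ne'
  have hD' : (c - b) * (l' - a) * (m' - a) ≠ 0 := (mul_pos (mul_pos hcb hla') hma').ne'
  -- equality of `X₃`
  have hB' : (c - l) * (c - m) = (c - l') * (c - m') := (div_left_inj' hK).mp hB
  -- cross-multiplied equality of the ratios `X₂/X₁`
  rw [div_eq_div_iff hD hD'] at hA
  have hE1 : (b - l) * (m - b) * ((l' - a) * (m' - a)) = (b - l') * (m' - b) * ((l - a) * (m - a)) := by
    have h : (c - a) * (c - b) * ((b - l) * (m - b) * ((l' - a) * (m' - a))) =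
        (c - a) * (c - b) * ((b - l') * (m' - b) * ((l - a) * (m - a))) := by
      linear_combination hA
    exact mul_left_cancel₀ hK h
  -- equality of `X₁`
  have hX1 : (l - a) * (m - a) = (l' - a) * (m' - a) := by
    have hpos : 0 < (l - a) * (m - a) * (c - b) + (b - l) * (m - b) * (c - a) :=
      add_pos (mul_pos (mul_pos hla hma) hcb) (mul_pos (mul_pos hbl hmb) hca)
    have h : ((l - a) * (m - a) - (l' - a) * (m' - a)) *
        ((l - a) * (m - a) * (c - b) + (b - l) * (m - b) * (c - a)) = 0 := by
      linear_combination (-((l - a) * (m - a) * (b - a))) * hB' - (c - a) * hE1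
    rcases mul_eq_zero.mp h with h | h
    · linarith
    · exact absurd h hpos.ne'
  -- Vieta: sum and product agree
  have hS : l + m = l' + m' := by
    have h : (c - a) * (l + m) = (c - a) * (l' + m') := by linear_combination hX1 - hB'
    exact mul_left_cancel₀ hca.ne' h
  have hP : l * m = l' * m' := by linear_combination hX1 + a * hS
  have hl : l = l' := by
    have h : (l - l') * (l - m') = 0 := by linear_combination l * hS - hP
    rcases mul_eq_zero.mp h with h | h
    · exact sub_eq_zero.mp h
    · exact absurd (sub_eq_zero.mp h) (hl2.trans hm1').ne
  exact ⟨hl, by linarith⟩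

/-- Injectivity of the hat-box map `Λ(λ,μ) = (u,z)` (tangent of the azimuth and height of the sphero-conal point
of `S²` with confocal coordinates `(λ,μ)`) on the open period rectangle `(e₁,e₂) × (e₂,e₃)`: the squares
`x₁² = (1−z²)/(1+u²)`, `x₂² = u²x₁²`, `x₃² = z²` determine `λ+μ` and `λμ` (Vieta), hence `λ < μ`. [folklore] -/
theorem stub_hatBoxInjOn :
    ∀ (e₁ e₂ e₃ : ℚ), e₁ < e₂ → e₂ < e₃ → 
      Set.InjOn (fun x : Fin 2 → ℝ => (![Real.sqrt (((e₃ : ℝ) - (e₁ : ℝ)) * ((e₂ : ℝ) - x 0) * (x 1 - (e₂ : ℝ)) / (((e₃ : ℝ) - (e₂ : ℝ)) * (x 0 - (e₁ : ℝ)) * (x 1 - (e₁ : ℝ)))), Real.sqrt (((e₃ : ℝ) - x 0) * ((e₃ : ℝ) - x 1) / (((e₃ : ℝ) - (e₁ : ℝ)) * ((e₃ : ℝ) - (e₂ : ℝ))))] : Fin 2 → ℝ))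
        {x : Fin 2 → ℝ | (e₁ : ℝ) < x 0 ∧ x 0 < (e₂ : ℝ) ∧ (e₂ : ℝ) < x 1 ∧ x 1 < (e₃ : ℝ)} := by
  intro e₁ e₂ e₃ _ _ x hx y hy hxy
  obtain ⟨hx1, hx2, hx3, hx4⟩ := hx
  obtain ⟨hy1, hy2, hy3, hy4⟩ := hy
  have h0 := congrFun hxy 0
  have h1 := congrFun hxy 1
  simp only [Matrix.cons_val_zero, Matrix.cons_val_one] at h0 h1
  -- nonnegativity of the radicands on the rectangle
  have hAnn : ∀ {l m : ℝ}, (e₁ : ℝ) < l → l < e₂ → (e₂ : ℝ) < m → m < e₃ →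
      0 ≤ ((e₃ : ℝ) - e₁) * ((e₂ : ℝ) - l) * (m - e₂) / (((e₃ : ℝ) - e₂) * (l - e₁) * (m - e₁)) := by
    intro l m hl1 hl2 hm1 hm2
    refine div_nonneg (mul_nonneg (mul_nonneg ?_ ?_) ?_) (mul_nonneg (mul_nonneg ?_ ?_) ?_) <;> linarith
  have hBnn : ∀ {l m : ℝ}, (e₁ : ℝ) < l → l < e₂ → (e₂ : ℝ) < m → m < e₃ →
      0 ≤ ((e₃ : ℝ) - l) * ((e₃ : ℝ) - m) / (((e₃ : ℝ) - e₁) * ((e₃ : ℝ) - e₂)) := by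
    intro l m hl1 hl2 hm1 hm2
    refine div_nonneg (mul_nonneg ?_ ?_) (mul_nonneg ?_ ?_) <;> linarith
  rw [Real.sqrt_inj (hAnn hx1 hx2 hx3 hx4) (hAnn hy1 hy2 hy3 hy4)] at h0
  rw [Real.sqrt_inj (hBnn hx1 hx2 hx3 hx4) (hBnn hy1 hy2 hy3 hy4)] at h1
  obtain ⟨hl, hm⟩ := hatBox_vieta hx1 hx2 hx3 hx4 hy1 hy2 hy3 hy4 h0 h1
  funext i
  fin_cases i
  · exact hl
  · exact hm

end Summit.KontsevichZagierPeriods.UnfoldedStokes.LegendreCubicFormLine
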